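import Mathlib
import Literature.Probability.RandomPlanarGeometry.ConformalRestrictionCovariance
import Literature.Probability.RandomPlanarGeometry.SLEExistenceNeEightHolds
import Literature.Probability.RandomPlanarGeometry.LatticeSimilarityCovariance
import Literature.Probability.RandomPlanarGeometry.LoewnerReflection
import Literature.Probability.RandomPlanarGeometry.SLERealAvoidance

/-!
# Crux `CardyRotToConfR2SymmetryUpgrade`, line `isotropy-kills-beltrami`: SLE₆ laws under (anti)similarities (S4c)

Stub `stub_sleSixIsometryInvariance` of the line skeleton for crux stmt-CriticalPhenomena-0698.

**Statement.** If `φ` is a similarity `z ↦ c z + w` (`c ≠ 0`) or an anti-similarity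
`z ↦ c z̄ + w` of the plane, then the push-forward along `φ` of a chordal SLE₆ law of a Dobrushin
domain `(D; a, b)` is a chordal SLE₆ law of the image domain `(φ D; φ a, φ b)`.

**Proof.**
* `isSLELaw_map_similarity` (similarity half): the family of SLE₆ laws
  `D ↦ Q D` (a choice, `exists_isSLELaw_of_ne_eight`) is conformally covariant
  (`ChordalFamily.isConformallyCovariant_of_isSLELaw`), hence similarity covariant
  (`IsConformallyCovariant.isSimilarityCovariant`); two SLE₆ laws of the same domain coincide
  (`IsSLELaw.unique'`).
* `isSLELaw_map_conj` (reflection half, `Complex.conjLIE.toHomeomorph : z ↦ z̄`): let `Γ` be an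
  SLE₆ random curve in `D` built from the chordal uniformizing map `φ : ℍ → D`, and
  `ψ := conj ∘ φ ∘ σ : ℍ → D̄` (`σ z = -z̄`, `exists_conjUniformizer`), a chordal uniformizing map of
  the conjugate domain whose boundary extension is `conj ∘ φ̄ ∘ σ` (`boundaryExtension_conj`,
  Carathéodory). Almost surely `conj (Γ ω)` is the class of the compactified `ψ̄`-image of the
  REFLECTED trace `σ ∘ γ(ω)`; an SLE₆ curve `Γ₁` of `D̄` (`exists_isSLECurve_six`, uniformizer
  `φ₁ = ψ ∘ (r •)`) is a.s. the class of the compactified `ψ̄`-image of the RESCALED trace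
  `t ↦ r γ(t / r²)`; and the reflected and rescaled traces have the same law on path space
  (`identDistrib_sleTrace_negConj`, symmetry `B ↦ -B` of the driving Brownian motion, and
  `identDistrib_sleTrace_scale_of_hasSLETrace`, Brownian scaling). Pushing this identity in law
  through the measurable compactification functional `compactifiedClass` gives
  `conj_* law(Γ) = law(Γ₁)`. (Template: `IsSLECurve.map_eq_of_hasSLETrace_scaling`.)
* `stub_sleSixIsometryInvariance`: `z ↦ c z̄ + w` is `conj` followed by a similarity; push-forwards
  compose (`MarkedDomain.map_map`, `Measure.map_map`, `CurveClass.map_homeomorph_trans`).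

Sources: Rohde–Schramm, *Basic properties of SLE*, Ann. Math. 161 (2005), §2 and §6 p. 901
("by symmetry"); Lawler, *Conformally invariant processes in the plane* (2005), §6.1, §6.3.
-/

noncomputable section

namespace Summit.CriticalPhenomena.CardyFormulaZ2.Theorems.CardyRotToConfR2SymmetryUpgrade.IsotropyKillsBeltrami

open MeasureTheory ProbabilityTheory Set Filter Topology
open Literature.Probability Literature.Probability.RandomPlanarGeometry
open UpperHalfPlane (upperHalfPlaneSet)
open scoped ENNReal NNReal unitInterval ComplexConjugate

/-! ### (A) The similarity half -/

/-- **SLE₆ laws under similarities.** The push-forward of a chordal SLE₆ law of `D` along the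
similarity `z ↦ c z + w` is a chordal SLE₆ law of the image domain: the family of SLE₆ laws is
conformally covariant, hence similarity covariant, and SLE₆ laws are unique. -/
theorem isSLELaw_map_similarity (c : ℂ) (hc : c ≠ 0) (w : ℂ) (D : DobrushinDomain)
    (μ : Measure (CurveClass ℂ)) (hμ : IsSLELaw 6 D μ) :
    IsSLELaw 6 (D.map (similarity c hc w))
      (μ.map (CurveClass.map ((similarity c hc w : ℂ ≃ₜ ℂ) : C(ℂ, ℂ)))) := by
  have hQ : ∀ D' : DobrushinDomain, IsSLELaw 6 D'
      (exists_isSLELaw_of_ne_eight (κ := 6) (by norm_num) (by norm_num) D').choose :=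
    fun D' => (exists_isSLELaw_of_ne_eight (κ := 6) (by norm_num) (by norm_num) D').choose_spec
  have hcov := (ChordalFamily.isConformallyCovariant_of_isSLELaw hQ).isSimilarityCovariant D c hc w
  rw [hμ.unique' (hQ D), ← hcov]
  exact hQ _

/-! ### (B) The reflection half -/

/-- **The conjugated uniformizing map.** If `φ : ℍ → D` is a chordal uniformizing map of
`(D; a, b)`, then `ψ := conj ∘ φ ∘ σ` (`σ z = -z̄`, the reflection in the imaginary axis, an
anticonformal involution of `ℍ` fixing `0` and `∞`) is a conformal equivalence of `ℍ` onto the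
conjugate domain `D̄ = D.map conj` with boundary values `ā` at `0` and `b̄` at `∞`, i.e. a chordal
uniformizing map of `(D̄; ā, b̄)`. -/
theorem exists_conjUniformizer (D : DobrushinDomain)
    (φ : ConformalEquiv upperHalfPlaneSet D.carrier) (hφ : D.IsChordalUniformizing φ) :
    ∃ ψ : ConformalEquiv upperHalfPlaneSet (D.map Complex.conjLIE.toHomeomorph).carrier,
      (∀ z, ψ z = conj (φ (imagAxisRefl z))) ∧
        (D.map Complex.conjLIE.toHomeomorph).IsChordalUniformizing ψ := by
  have hσH : ∀ {z : ℂ}, z ∈ upperHalfPlaneSet → imagAxisRefl z ∈ upperHalfPlaneSet :=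
    fun hz => by simpa using hz
  -- holomorphy of `conj ∘ φ ∘ σ` on `ℍ`
  have hd : DifferentiableOn ℂ (fun z => conj (φ (imagAxisRefl z))) upperHalfPlaneSet := by
    have h := (DifferentiableOn.imagAxisRefl_comp φ.differentiableOn_coe).neg
    rw [imagAxisRefl_preimage_upperHalfPlaneSet] at h
    refine h.congr fun z _ => ?_
    simp only [Pi.neg_apply, imagAxisRefl_apply, neg_neg]
  -- holomorphy of `σ ∘ φ⁻¹ ∘ conj` on `D̄`
  have hd' : DifferentiableOn ℂ (fun w => imagAxisRefl (φ.symm (conj w)))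
      (D.map Complex.conjLIE.toHomeomorph).carrier := by
    have h := DifferentiableOn.imagAxisRefl_comp φ.symm.differentiableOn_coe
    have hmaps : MapsTo (Neg.neg : ℂ → ℂ) (D.map Complex.conjLIE.toHomeomorph).carrier
        (imagAxisRefl ⁻¹' D.carrier) := by
      rintro _ ⟨v, hv, rfl⟩
      simpa [conjLIE_toHomeomorph_apply] using hv
    refine (h.comp (differentiableOn_neg _) hmaps).congr fun w _ => ?_
    simp only [Function.comp_apply, imagAxisRefl_apply, map_neg, neg_neg]
  refine ⟨{ toFun := fun z => conj (φ (imagAxisRefl z))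
            invFun := fun w => imagAxisRefl (φ.symm (conj w))
            source := upperHalfPlaneSet
            target := (D.map Complex.conjLIE.toHomeomorph).carrier
            map_source' := fun z hz => ⟨φ (imagAxisRefl z), φ.mapsTo (hσH hz), rfl⟩
            map_target' := ?_
            left_inv' := fun z hz => by
              simp only [Complex.conj_conj]
              rw [φ.symm_apply_apply (hσH hz), imagAxisRefl_imagAxisRefl]
            right_inv' := ?_
            source_eq := rfl
            target_eq := rfl
            differentiableOn := hd
            differentiableOn_symm := hd' }, fun z => rfl, ?_, ?_⟩
  · rintro _ ⟨v, hv, rfl⟩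
    simp only [conjLIE_toHomeomorph_apply, Complex.conj_conj]
    exact hσH (φ.symm_mapsTo hv)
  · rintro _ ⟨v, hv, rfl⟩
    simp only [conjLIE_toHomeomorph_apply, Complex.conj_conj, imagAxisRefl_imagAxisRefl]
    rw [φ.apply_symm_apply hv]
  · -- boundary value `ā` at `0`
    show Tendsto (fun z => conj (φ (imagAxisRefl z))) (𝓝[upperHalfPlaneSet] 0)
      (𝓝 ((D.map Complex.conjLIE.toHomeomorph).pt 0))
    rw [MarkedDomain.pt_map, conjLIE_toHomeomorph_apply]
    have h1 := tendsto_imagAxisRefl_nhdsWithin upperHalfPlaneSet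
    rw [imagAxisRefl_image_upperHalfPlaneSet] at h1
    exact (Complex.continuous_conj.tendsto _).comp (hφ.1.comp h1)
  · -- boundary value `b̄` at `∞`
    show Tendsto (fun z => conj (φ (imagAxisRefl z))) (cocompact ℂ ⊓ 𝓟 upperHalfPlaneSet)
      (𝓝 ((D.map Complex.conjLIE.toHomeomorph).pt 1))
    rw [MarkedDomain.pt_map, conjLIE_toHomeomorph_apply]
    have h1 := tendsto_imagAxisRefl_cocompact_inf upperHalfPlaneSet
    rw [imagAxisRefl_image_upperHalfPlaneSet] at h1
    exact (Complex.continuous_conj.tendsto _).comp (hφ.2.comp h1)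

/-- **Boundary extension of the conjugated uniformizing map**: on the closed upper half-plane,
`ψ̄ = conj ∘ φ̄ ∘ σ` for `ψ = conj ∘ φ ∘ σ` (`φ : ℍ → D` onto a Jordan domain has boundary values at
all real points by Carathéodory's theorem, `JordanDomain.exists_hasBoundaryValue_holds`, and
`σ`, `conj` are homeomorphisms). -/
theorem boundaryExtension_conj {D : DobrushinDomain}
    (φ : ConformalEquiv upperHalfPlaneSet D.carrier)
    (ψ : ConformalEquiv upperHalfPlaneSet (D.map Complex.conjLIE.toHomeomorph).carrier)
    (hψ : ∀ z, ψ z = conj (φ (imagAxisRefl z))) {w : ℂ} (hw : 0 ≤ w.im) :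
    ψ.boundaryExtension w = conj (φ.boundaryExtension (imagAxisRefl w)) := by
  have hcl : ∀ {z : ℂ}, 0 ≤ z.im → z ∈ closure upperHalfPlaneSet := fun hz => by
    rw [ConformalEquiv.closure_upperHalfPlaneSet_eq]
    exact hz
  have hw' : 0 ≤ (imagAxisRefl w).im := by simpa using hw
  -- `φ` has a boundary value `p` at `σ w`
  obtain ⟨p, hp⟩ : ∃ p, φ.HasBoundaryValue (imagAxisRefl w) p := by
    by_cases hzH : imagAxisRefl w ∈ upperHalfPlaneSet
    · exact ⟨_, φ.hasBoundaryValue_apply hzH⟩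
    · have h0 : (imagAxisRefl w).im = 0 := le_antisymm (not_lt.1 hzH) hw'
      obtain ⟨p, -, hp⟩ :=
        JordanDomain.exists_hasBoundaryValue_holds D.toJordanDomain φ (imagAxisRefl w).re
      refine ⟨p, ?_⟩
      convert hp using 2
      exact Complex.ext (by simp) (by rw [h0]; simp)
  rw [φ.boundaryExtension_eq_of_hasBoundaryValue (hcl hw') hp]
  refine ψ.boundaryExtension_eq_of_hasBoundaryValue (hcl hw) ?_
  have h1 : Tendsto imagAxisRefl (𝓝[upperHalfPlaneSet] w)
      (𝓝[upperHalfPlaneSet] (imagAxisRefl w)) :=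
    imagAxisRefl.continuous.continuousWithinAt.tendsto_nhdsWithin fun z hz => by simpa using hz
  have h2 : Tendsto (fun z => conj (φ (imagAxisRefl z))) (𝓝[upperHalfPlaneSet] w)
      (𝓝 (conj p)) :=
    (Complex.continuous_conj.tendsto p).comp (hp.comp h1)
  exact h2.congr fun z => (hψ z).symm

/-- **SLE₆ laws under complex conjugation.** The push-forward along `z ↦ z̄` of a chordal SLE₆
law of `(D; a, b)` is a chordal SLE₆ law of `(D̄; ā, b̄)`: reflection symmetry `B ↦ -B` of the
driving Brownian motion (`identDistrib_sleTrace_negConj`), Brownian scaling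
(`identDistrib_sleTrace_scale_of_hasSLETrace`) and the conjugated uniformizing map
`conj ∘ φ ∘ σ`; Rohde–Schramm (2005), §2, §6 p. 901. -/
theorem isSLELaw_map_conj (D : DobrushinDomain) (μ : Measure (CurveClass ℂ))
    (hμ : IsSLELaw 6 D μ) :
    IsSLELaw 6 (D.map Complex.conjLIE.toHomeomorph)
      (μ.map (CurveClass.map ((Complex.conjLIE.toHomeomorph : ℂ ≃ₜ ℂ) : C(ℂ, ℂ)))) := by
  obtain ⟨Γ, hΓ, rfl⟩ := hμ
  have hκ : HasSLETrace 6 := hΓ.hasSLETrace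
  obtain ⟨hΓm, φ, hφ, hae⟩ := hΓ
  obtain ⟨ψ, hψapply, hψ⟩ := exists_conjUniformizer D φ hφ
  -- an SLE₆ random curve in the conjugate domain, and its uniformizing map `φ₁ = ψ ∘ (r • ·)`
  obtain ⟨Γ₁, hΓ₁⟩ := exists_isSLECurve_six (D.map Complex.conjLIE.toHomeomorph)
  obtain ⟨φ₁, hφ₁, hae₁⟩ := hΓ₁.2
  obtain ⟨r, hr, hEq⟩ := MarkedDomain.IsChordalUniformizing.exists_eq_trans_smul_of_disc
    JordanDomain.exists_continuousOn_extension_holds hψ hφ₁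
  obtain ⟨rn, hrn0, hrn⟩ : ∃ rn : ℝ≥0, rn ≠ 0 ∧ (rn : ℝ) = r :=
    ⟨r.toNNReal, (Real.toNNReal_pos.2 hr).ne', Real.coe_toNNReal r hr.le⟩
  -- the measurable compactification functional of `ψ`
  have hΦm : Measurable ψ.truncatedBoundaryExtension :=
    ConformalEquiv.measurable_truncatedBoundaryExtension
      JordanDomain.continuousOn_boundaryExtension_holds
      (D.map Complex.conjLIE.toHomeomorph).toJordanDomain ψ
  have hΨ : Measurable (compactifiedClass ψ.truncatedBoundaryExtension
      ((D.map Complex.conjLIE.toHomeomorph).pt 1)) :=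
    measurable_compactifiedClass hΦm _
  -- reflected and rescaled traces have the same law
  have hID : IdentDistrib (fun ω t => -conj (sleTrace 6 ω t))
      (fun ω t => (rn : ℂ) * sleTrace 6 ω (t / rn ^ 2))
      Process.preWienerMeasure Process.preWienerMeasure :=
    (identDistrib_sleTrace_negConj hκ).symm.trans
      (identDistrib_sleTrace_scale_of_hasSLETrace hκ hrn0)
  -- a.s. `conj (Γ ω)` is the compactified `ψ̄`-image of the reflected trace
  have hΓ₁' : (CurveClass.map ((Complex.conjLIE.toHomeomorph : ℂ ≃ₜ ℂ) : C(ℂ, ℂ)) ∘ Γ)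
      =ᵐ[Process.preWienerMeasure]
      compactifiedClass ψ.truncatedBoundaryExtension
          ((D.map Complex.conjLIE.toHomeomorph).pt 1) ∘
        fun ω t => -conj (sleTrace 6 ω t) := by
    filter_upwards [hae] with ω ⟨hgen, c, hΓc, hc⟩
    rw [Function.comp_apply, hΓc, CurveClass.map_mk, Function.comp_apply]
    symm
    refine IsCompactifiedImage.compactifiedClass_eq ⟨fun s hs => ?_, ?_⟩
    · have him : 0 ≤ (-conj (sleTrace 6 ω (rayParam s))).im := by
        simpa using hgen.im_nonneg (rayParam s)
      rw [Curve.map_apply, hc.1 s hs, ψ.truncatedBoundaryExtension_eq him,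
        boundaryExtension_conj φ ψ hψapply him]
      simp only [ContinuousMap.coe_coe, conjLIE_toHomeomorph_apply, imagAxisRefl_apply, map_neg,
        Complex.conj_conj, neg_neg]
    · rw [Curve.map_apply, hc.2, MarkedDomain.pt_map]
      rfl
  -- a.s. `Γ₁ ω` is the compactified `ψ̄`-image of the rescaled trace
  have hΓ₂ : Γ₁ =ᵐ[Process.preWienerMeasure]
      compactifiedClass ψ.truncatedBoundaryExtension
          ((D.map Complex.conjLIE.toHomeomorph).pt 1) ∘
        fun ω t => (rn : ℂ) * sleTrace 6 ω (t / rn ^ 2) := by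
    filter_upwards [hae₁] with ω ⟨hgen, c, hΓc, hc⟩
    rw [Function.comp_apply, hΓc]
    have hc' : IsCompactifiedImage ψ.truncatedBoundaryExtension
        (fun t => (rn : ℂ) * sleTrace 6 ω (rn ^ 2 * t / rn ^ 2))
        ((D.map Complex.conjLIE.toHomeomorph).pt 1) c := by
      refine ⟨fun s hs => ?_, hc.2⟩
      have him : 0 ≤ ((rn : ℂ) * sleTrace 6 ω (rayParam s)).im := by
        rw [Complex.im_ofReal_mul]
        exact mul_nonneg rn.2 (hgen.im_nonneg _)
      rw [hc.1 s hs, ψ.boundaryExtension_eq_of_eqOn_smul_trans φ₁ hr hEq]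
      beta_reduce
      rw [mul_div_cancel_left₀ _ (pow_ne_zero 2 hrn0), ψ.truncatedBoundaryExtension_eq him,
        Complex.real_smul, ← hrn]
    have key := IsCompactifiedImage.of_comp_mul
      (γ := fun t => (rn : ℂ) * sleTrace 6 ω (t / rn ^ 2)) (pow_ne_zero 2 hrn0) hc'
    rw [key.compactifiedClass_eq, CurveClass.mk_reparam]
  -- push the identity in law through the functional
  have key : (Process.preWienerMeasure.map Γ).map
      (CurveClass.map ((Complex.conjLIE.toHomeomorph : ℂ ≃ₜ ℂ) : C(ℂ, ℂ))) =
      Process.preWienerMeasure.map Γ₁ :=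
    calc (Process.preWienerMeasure.map Γ).map
          (CurveClass.map ((Complex.conjLIE.toHomeomorph : ℂ ≃ₜ ℂ) : C(ℂ, ℂ)))
        = Process.preWienerMeasure.map
            (CurveClass.map ((Complex.conjLIE.toHomeomorph : ℂ ≃ₜ ℂ) : C(ℂ, ℂ)) ∘ Γ) :=
          AEMeasurable.map_map_of_aemeasurable (CurveClass.measurable_map _).aemeasurable hΓm
      _ = Process.preWienerMeasure.map
            (compactifiedClass ψ.truncatedBoundaryExtension
                ((D.map Complex.conjLIE.toHomeomorph).pt 1) ∘
              fun ω t => -conj (sleTrace 6 ω t)) :=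
          Measure.map_congr hΓ₁'
      _ = (Process.preWienerMeasure.map fun ω t => -conj (sleTrace 6 ω t)).map
            (compactifiedClass ψ.truncatedBoundaryExtension
              ((D.map Complex.conjLIE.toHomeomorph).pt 1)) :=
          (AEMeasurable.map_map_of_aemeasurable hΨ.aemeasurable hID.aemeasurable_fst).symm
      _ = (Process.preWienerMeasure.map fun ω t => (rn : ℂ) * sleTrace 6 ω (t / rn ^ 2)).map
            (compactifiedClass ψ.truncatedBoundaryExtension
              ((D.map Complex.conjLIE.toHomeomorph).pt 1)) := by
          rw [hID.map_eq]
      _ = Process.preWienerMeasure.map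
            (compactifiedClass ψ.truncatedBoundaryExtension
                ((D.map Complex.conjLIE.toHomeomorph).pt 1) ∘
              fun ω t => (rn : ℂ) * sleTrace 6 ω (t / rn ^ 2)) :=
          AEMeasurable.map_map_of_aemeasurable hΨ.aemeasurable hID.aemeasurable_snd
      _ = Process.preWienerMeasure.map Γ₁ := (Measure.map_congr hΓ₂).symm
  rw [key]
  exact hΓ₁.isSLELaw_map

/-! ### The stub -/

/-- Registered stub `stub_sleSixIsometryInvariance` (S4c · SLE₆ LAWS UNDER (ANTI)SIMILARITIES).
The push-forward of the chordal SLE₆ law of `D` along a similarity `z ↦ c z + w` or an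
anti-similarity `z ↦ c z̄ + w` is the chordal SLE₆ law of the image domain. Similarity half:
`isSLELaw_map_similarity` (conformal covariance and uniqueness of the SLE₆ laws); reflection
half: `isSLELaw_map_conj` (symmetry `B ↦ -B` of the driving function and the conjugated
uniformizing map `conj ∘ φ ∘ σ`), composed by functoriality of push-forwards
(`MarkedDomain.map_map`, `Measure.map_map`, `CurveClass.map_homeomorph_trans`).
Rohde–Schramm (2005), §2; Lawler (2005), §6. -/
theorem stub_sleSixIsometryInvariance :
    ∀ φ : ℂ ≃ₜ ℂ,
      (∃ (c : ℂ) (hc : c ≠ 0) (w : ℂ), φ = similarity c hc w ∨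
        φ = Complex.conjLIE.toHomeomorph.trans (similarity c hc w)) →
      ∀ (D : DobrushinDomain) (μ : Measure (CurveClass ℂ)), IsSLELaw 6 D μ →
        IsSLELaw 6 (D.map φ) (μ.map (CurveClass.map (φ : C(ℂ, ℂ)))) := by
  rintro φ ⟨c, hc, w, rfl | rfl⟩ D μ hμ
  · exact isSLELaw_map_similarity c hc w D μ hμ
  · have h := isSLELaw_map_similarity c hc w _ _ (isSLELaw_map_conj D μ hμ)
    rwa [MarkedDomain.map_map,
      Measure.map_map (CurveClass.measurable_map _) (CurveClass.measurable_map _),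
      ← CurveClass.map_homeomorph_trans] at h

end Summit.CriticalPhenomena.CardyFormulaZ2.Theorems.CardyRotToConfR2SymmetryUpgrade.IsotropyKillsBeltrami

end
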